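import Summits.NavierStokesRegularity.NavierStokesRegularity.Theses.PerpetualPump
import Summits.NavierStokesRegularity.NavierStokesRegularity.Theorems.CircuitTrace.Negative.LoadBearing
-- Proof templates for stub_clock / stub_observability (trilinear_cancel, block_backward_gronwall,
-- circuitRHS_abs_le, exists_coeff_bound) are LANDED and importable by the stub workers:
-- import Summits.NavierStokesRegularity.NavierStokesRegularity.Theorems.CircuitTrace.Negative.Structure

/-!
# Line `one-sided-source-cascade` — crux `PerpetualPump.CircuitTrace` (stmt-NavierStokesRegularity-1836)

Crux-plan skeleton (planner, crux-plan mode, round 1).  Idea card: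
`Cruxes/CircuitTrace/Ideas/one-sided-source-cascade.md` (ideator 2), sharpened by the triage panel
(`TRIAGE-r1-{1,2,3}.md`: "take BandObservability as the F1 stub, skip the √-cascade, add the
`0 ≤ A` guard, pace with the Type-I clock + the adjacency lemma") and by the standing disprover's
architecture (`Cruxes/CircuitTrace/Disproof.lean`, steps 1–4: records → pacing → weighted block
Grönwall at every depth → `ℓ³` counting).

## The line in one paragraph

Units: critical amplitude `a_{i,n}(t) = lam^{n/5} |X_{i,n}(t)|`, clock of scale `n` = `lam^{4n/5}`.
Suppose the conclusion of the crux fails (no uniform `H¹⁰` bound on `[0,T)`).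
(1) `stub_quietTail` (F3, weighted maximum principle): then NO tail block `{n ≥ k+1}` is
`δ₁`-quiet on a final interval `[t₁,T)` — activity at level `δ₁` recurs in every tail block up to `T`.
(2) `stub_clock` (F2, ramp-localised energy budget in critical units + the topology of quiet/active
times): for every large `k` there is a LAST `δ/2`-quiet time `s` of the block `{n ≥ k+1}` (or a quiet
time as close to `T` as we like), with `T - s ≤ C·lam^{-4k/5}` (the Type-I clock: while some scale
`≥ k+1` is `δ/2`-active the ramp energy burns at rate `≳ δ² lam^{2k/5}` out of a budget
`≲ M^{2/3} lam^{-2k/5}`), followed by a FIRST time `t'` at which the block reaches level `δ`.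
(3) `stub_adjacency` (F3, first-entry maximum principle; the ONE-SIDED SOURCE structure of Tao's
offset set `S`: the only additive term in the equation of scale `k+1` is the square of scale `k`):
between `s` and `t'` scale `k` itself carries amplitude `≥ η(δ) > 0` at some time `u`.
Hence SYNCHRONY: every large scale `k` is `η`-active at a time `u_k` within `C` own-clock units of `T`.
(4) `stub_observability` (F1, THE LEVER of the card = the weighted / critical-unit version of the
disprover's `block_backward_gronwall`, "what provers still have to build"): on the block `{0,…,N}`
every monomial driving a scale `q` has a factor at a scale `≤ q`, the clocks are `≤ lam^{4N/5}`, and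
below scale `0` there is nothing (cutoff) — so the `θ`-discounted critical sup of the block at a LATER
time dominates `e^{-L·lam^{4N/5}(t-u)}` times the discounted amplitude of ANY block scale at the
earlier time `u` ("you cannot sweep behind yourself": bottom leak is zero).
(5) `stub_trailDivergence` (Disproof steps 3–4): apply (4) with `N = k`, `u = u_k` for all
`k ∈ [k₀,K]` at the common time `t* = max u_k`: each `k` leaves a scale `q_k ∈ [k-D,k]` with
amplitude `≥ ρ = e^{-LC}η` at time `t*` (`D = log_{1/θ}(M^{1/3}/ρ)`), so `≥ (K-k₀+1)/(D+1)` DISTINCT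
scales carry `≥ ρ` simultaneously and `Σ a³(t*) ≥ (K-k₀+1)ρ³/(D+1) > M` for `K` large — contradicting
the `ℓ³` hypothesis.  `CircuitTrace_of` is this composition, sorry-free; the five `stub_*` are the
only gaps.

## Disproof.lean, honoured

* `circuitTrace_false_without_apriori` (landed: `Theorems/CircuitTrace/Negative/LoadBearing.lean`):
  any proof must use the a-priori `H¹⁰` bound `H`.  This line uses `H` in `stub_quietTail` (the
  weighted sup over a tail block is attained / `θ ↑ 1` trick; bound on `[0,t₁]`) and in `stub_clock`
  (termwise differentiation of the ramp energy; high scales initially quiet; the active set on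
  `[0,T'']` involves finitely many scales).  `stub_adjacency`, `stub_observability`,
  `stub_trailDivergence` do not need `H` and do not claim the crux without it (they are segment
  lemmas / a counting lemma, not instances of `CircuitTraceWithoutApriori`).
* `circuitTraceWithoutL3_false` (mod `MaximalH10Solutions`): `ℓ³` is used exactly once, in
  `stub_trailDivergence` (Step 4 counting); stubs 1–4 use only the `ℓ^∞` consequence `a ≤ M^{1/3}`,
  consistently with the disprover's remark that Steps 1–3 hold under the `ℓ^∞` bound alone and with
  `CircuitTraceLinfty` being conjecturally FALSE (no stub asserts anything at `q = ∞`; the line proves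
  `CircuitTraceLq` for every `q < ∞` verbatim).
* `block_backward_gronwall` / `circuitRHS_abs_le` / `circuitRHS_eq_zero_of_vanishing_below` /
  `exists_coeff_bound` — LANDED in `Theorems/CircuitTrace/Negative/Structure.lean` (p74903 accepted,
  commit 65cabc038ec3; namespace `…Theorems.CircuitTrace.Negative`; workers import it — it is not
  needed to state the stubs, so this skeleton does not):
  `stub_observability` is their weighted critical-unit form; provers should copy that proof
  (`X̃_{i,q} = θ^{N-q} lam^{q/5} X_{i,q}`, sup norm on `Fin m × Fin (N+1)`,
  `norm_le_gronwallBound_of_norm_deriv_right_le` in reversed time).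
* `trilinear_cancel` — LANDED in the same `Negative/Structure.lean`: the energy identity behind
  `stub_clock`'s ramp functional (flux through a cut = the single `μ = some 2` triad family).
* Disproof.lean v3 §6 (2026-08-16T01:40Z, "ideator first lemmas — cheap attacks"): records
  `Ideator2.BandObservability` TRUE (= `stub_observability` here, band = whole low block, zero leak),
  `Ideator2.TypeIClock` TRUE (forward timing; here `stub_clock`, with the episode counting replaced
  by the dichotomy "quiet times accumulate at `T` or not"), and flags `Ideator3.ValveBudget` as
  SUSPECT AS STATED (influx through a `δ`-quiet valve is the same order `δ²` as the dissipation of a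
  `δ`-active scale; ratio `2m³A M^{1/3} lam^{-3/5}` must be `< 1`).  THIS LINE HAS NO QUIET VALVE:
  `stub_clock`'s ramp budget spreads the cut flux over `K'` cuts with weight `1/K'` each and bounds it
  crudely by `a ≤ M^{1/3}`, so the defect is made `≤ δ²/4 · lam^{2k/5}` by taking `K'` large, at the
  price of a budget factor `lam^{2K'/5}` that is INDEPENDENT of `k` — no smallness condition on
  `m, K, M, lam` is needed (constants in the docstring of `stub_clock`).
* Typed-stub defects found by triage (`not_PersistenceOrBlame`, `not_bandObservability_as_typed`:
  vacuous `|coeff| ≤ A` with `A < 0` at `m = 0`): avoided — no stub quantifies a free bound `A`;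
  constants are existential AFTER `coeff` (`∃ δ₀`, `∃ η`, `∃ L`), and every `m = 0` instance of every
  stub is true (checked by hand: the activity hypotheses `∃ i : Fin 0, …` are then unsatisfiable).

The only non-Mathlib names in the stub signatures are the FULLY QUALIFIED decls of the LANDED,
sorry-free file `Summits/NavierStokesRegularity/NavierStokesRegularity/Theorems/CircuitTrace/Negative/
LoadBearing.lean` (p73393 accepted, commit 27fe311ef14d; namespace
`Summit.NavierStokesRegularity.NavierStokesRegularity.Theorems.CircuitTrace.Negative`): `circuitRHS`
(verbatim the crux's `let F`), `IsSymm` (4.2), `IsCyclic` (4.3), and in the composition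
`circuitTrace_iff : CircuitTrace ↔ CircuitTrace'` (`Iff.rfl`).  Stub signatures are written out in
full (no local definitions, no `open` needed), so each can land verbatim as its own
`Theorems/PerpetualPumpCircuitTrace<Stub>.lean` with the two imports of this file (plus
`…Negative.Structure` for the landed proof templates, see the commented import above).
-/

noncomputable section

set_option linter.dupNamespace false

namespace Summit.NavierStokesRegularity.NavierStokesRegularity.Cruxes.CircuitTrace.OneSidedSourceCascade

open Summit.NavierStokesRegularity.NavierStokesRegularity.Theses.PerpetualPump (CircuitTrace)

/-! ## Stub 1 — quiet tail ⇒ regular (F3: weighted maximum principle; uses the a-priori bound) -/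

/-- **stub_quietTail** (ε-regularity of a quiet tail block; size M).  Under the crux hypotheses there
is a threshold `δ₁ = δ₁(lam, m, coeff) > 0` (it may be chosen after everything, only positivity is
used downstream) such that: if some tail block `{n ≥ k+1}` is `δ₁`-quiet in critical units on a whole
final interval `[t₁, T)`, `0 < t₁ < T`, then the `H¹⁰`-weighted amplitudes `lam^{4n}|X_{i,n}|` stay
bounded on `[0,T)` (the crux's conclusion).  Proof sketch: on `[0,t₁]` use the a-priori bound; on
`[t₁,T)` the finitely many scales `≤ k` are bounded by `M^{1/3} lam^{19k/5}`; on the block, with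
`b_{i,n} = lam^{4n}|X_{i,n}| = lam^{19n/5} a_{i,n}`, every nonlinear term of `ḃ_{i,n}` is
`≤ lam^{4n/5}·(4 m² K lam^{16/5} δ₁)·sup b` except the source into `n = k+1` from scale `k`, which is
`≤ lam^{4n/5}·K m² lam^{16/5} M^{1/3}·b_k ≤ const(k)`; so for `4 m² K lam^{16/5} δ₁ ≤ 1/2` the weighted
sup (made a max by weights `θⁿ`, `θ ↑ 1`, thanks to the a-priori bound on `[0,T'']`) obeys a maximum
principle.  Leans on: Mathlib ODE comparison (`image_le_of_deriv_right_lt_deriv_boundary` pattern) or a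
first-exit-time argument; `Theorems.CircuitTrace.Negative.circuitRHS`.  Consistent with
`circuitTrace_false_without_apriori` (uses H). -/
theorem stub_quietTail :
    ∀ lam : ℝ, 1 < lam → ∀ (m : ℕ) (coeff : Fin m → Fin m → Fin m → Option (Fin 3) → ℝ),
    Summit.NavierStokesRegularity.NavierStokesRegularity.Theorems.CircuitTrace.Negative.IsSymm coeff →
    Summit.NavierStokesRegularity.NavierStokesRegularity.Theorems.CircuitTrace.Negative.IsCyclic coeff →
    ∀ T : ℝ, 0 < T → ∀ X : Fin m → ℤ → ℝ → ℝ,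
    (∀ (i : Fin m) (n : ℤ), ContinuousOn (X i n) (Set.Ico 0 T)) →
    (∀ (i : Fin m) (n : ℤ), ∀ t ∈ Set.Ioo 0 T,
      HasDerivAt (X i n) (Summit.NavierStokesRegularity.NavierStokesRegularity.Theorems.CircuitTrace.Negative.circuitRHS lam coeff X i n t) t) →
    (∀ (i : Fin m) (n : ℤ) (t : ℝ), n < 0 → X i n t = 0) →
    (∀ T' ∈ Set.Ioo 0 T, ∃ C : ℝ, ∀ (i : Fin m) (n : ℤ), ∀ t ∈ Set.Icc 0 T',
      lam ^ ((4 : ℝ) * n) * |X i n t| ≤ C) →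
    (∃ M : ℝ, ∀ t ∈ Set.Ico 0 T, ∀ s : Finset ℤ,
      ∑ n ∈ s, ∑ i : Fin m, (lam ^ ((1 / 5 : ℝ) * n) * |X i n t|) ^ 3 ≤ M) →
    ∃ δ₁ : ℝ, 0 < δ₁ ∧
      ((∃ (k : ℕ) (t₁ : ℝ), t₁ ∈ Set.Ioo 0 T ∧ ∀ t ∈ Set.Ico t₁ T, ∀ (i : Fin m) (n : ℤ),
          (k : ℤ) + 1 ≤ n → lam ^ ((1 / 5 : ℝ) * n) * |X i n t| ≤ δ₁) →
        ∃ C : ℝ, ∀ (i : Fin m) (n : ℤ), ∀ t ∈ Set.Ico 0 T, lam ^ ((4 : ℝ) * n) * |X i n t| ≤ C) := by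
  sorry

/-! ## Stub 2 — the Type-I clock with first-crossing structure (F2: ramp energy; HARDEST) -/

/-- **stub_clock** (Type-I clock + last-quiet / first-crossing times of a tail block; size L — the
hardest stub).  Under the crux hypotheses and TAIL RECURRENCE at some level `δ₁ > 0` (the negated
antecedent of `stub_quietTail`: no tail block is `δ₁`-quiet on a final interval), for every `δ₀ > 0`
there are `δ ∈ (0, δ₀]` (take `δ ≤ δ₁` too), `C` and `k₀` such that for every `k ≥ k₀` there are times
`0 < s ≤ t' < T` with: `T - s ≤ C·lam^{-4k/5}`; the block `{n ≥ k+1}` is `δ/2`-quiet at `s`; it stays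
`≤ δ` on `[s,t']`; and some scale `≥ k+1` reaches `δ` at `t'`.  Proof sketch: `Q` = `δ/2`-quiet times of
the block in `(0,T)` is closed and contains `(0,T/2]` for `k ≥ k₀` (a-priori bound ⇒ high scales tiny);
`A` = times some block scale is `≥ δ` accumulates at `T` (tail recurrence, `δ ≤ δ₁`) and `A ∩ [0,T'']`
is a finite union of closed sets (a-priori bound).  If `sup Q = T` pick `s ∈ Q` with
`T - s ≤ lam^{-4k/5}`; else `s := max Q`, after which some block mode is always `> δ/2`, and the RAMP
ENERGY `W = Σ_n w_n |X_n|²` (`w` rising linearly from `0` at `k+1-K'` to `1` at `k+1`; by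
`trilinear_cancel` `dW/dt = -2Σ w_n lam^{4n/5}|X_n|² + Σ_b (w_{b+1}-w_b)·flux_b`,
`|flux_b| ≤ 2m³K lam^{2b/5} a_b² a_{b+1}`) burns at rate `≥ (3δ²/8) lam^{2k/5}` for
`K' ≥ 16 m³ K M /(δ²(1-lam^{-2/5}))` out of `W(s) ≤ m M^{2/3} lam^{2K'/5} lam^{-2(k+1)/5}/(1-lam^{-2/5})`,
whence `T - s ≤ C lam^{-4k/5}`; finally `t' := min (A ∩ [s,T))`.  Leans on:
`Theorems.CircuitTrace.Negative.trilinear_cancel` (LANDED, Negative/Structure.lean; energy flux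
through a cut is the single `μ = some 2` triad family), `…Negative.exists_coeff_bound`, termwise
differentiation of `W` under the a-priori bound (`hasDerivAt_tsum` pattern),
`IsClosed.sSup_mem`/`IsCompact.exists_isLeast` patterns.  No quiet valve, hence untouched by the
disprover's §6 caveat on `ValveBudget`.  Consistent with the Type-I facet `TruncatedDyadicTypeIBlowup` (its witness obeys this clock
with equality) and with `circuitTrace_false_without_apriori` (uses H). -/
theorem stub_clock :
    ∀ lam : ℝ, 1 < lam → ∀ (m : ℕ) (coeff : Fin m → Fin m → Fin m → Option (Fin 3) → ℝ),
    Summit.NavierStokesRegularity.NavierStokesRegularity.Theorems.CircuitTrace.Negative.IsSymm coeff →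
    Summit.NavierStokesRegularity.NavierStokesRegularity.Theorems.CircuitTrace.Negative.IsCyclic coeff →
    ∀ T : ℝ, 0 < T → ∀ X : Fin m → ℤ → ℝ → ℝ,
    (∀ (i : Fin m) (n : ℤ), ContinuousOn (X i n) (Set.Ico 0 T)) →
    (∀ (i : Fin m) (n : ℤ), ∀ t ∈ Set.Ioo 0 T,
      HasDerivAt (X i n) (Summit.NavierStokesRegularity.NavierStokesRegularity.Theorems.CircuitTrace.Negative.circuitRHS lam coeff X i n t) t) →
    (∀ (i : Fin m) (n : ℤ) (t : ℝ), n < 0 → X i n t = 0) →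
    (∀ T' ∈ Set.Ioo 0 T, ∃ C : ℝ, ∀ (i : Fin m) (n : ℤ), ∀ t ∈ Set.Icc 0 T',
      lam ^ ((4 : ℝ) * n) * |X i n t| ≤ C) →
    (∃ M : ℝ, ∀ t ∈ Set.Ico 0 T, ∀ s : Finset ℤ,
      ∑ n ∈ s, ∑ i : Fin m, (lam ^ ((1 / 5 : ℝ) * n) * |X i n t|) ^ 3 ≤ M) →
    ∀ δ₁ : ℝ, 0 < δ₁ →
    (¬ ∃ (k : ℕ) (t₁ : ℝ), t₁ ∈ Set.Ioo 0 T ∧ ∀ t ∈ Set.Ico t₁ T, ∀ (i : Fin m) (n : ℤ),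
        (k : ℤ) + 1 ≤ n → lam ^ ((1 / 5 : ℝ) * n) * |X i n t| ≤ δ₁) →
    ∀ δ₀ : ℝ, 0 < δ₀ →
    ∃ δ : ℝ, 0 < δ ∧ δ ≤ δ₀ ∧ ∃ C : ℝ, ∃ k₀ : ℕ, ∀ k : ℕ, k₀ ≤ k →
      ∃ s t' : ℝ, 0 < s ∧ s ≤ t' ∧ t' < T ∧ T - s ≤ C * lam ^ (-((4 / 5 : ℝ) * k)) ∧
        (∀ (i : Fin m) (n : ℤ), (k : ℤ) + 1 ≤ n → lam ^ ((1 / 5 : ℝ) * n) * |X i n s| ≤ δ / 2) ∧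
        (∀ (i : Fin m) (n : ℤ), (k : ℤ) + 1 ≤ n → ∀ t ∈ Set.Icc s t',
          lam ^ ((1 / 5 : ℝ) * n) * |X i n t| ≤ δ) ∧
        (∃ (i : Fin m) (n : ℤ), (k : ℤ) + 1 ≤ n ∧ δ ≤ lam ^ ((1 / 5 : ℝ) * n) * |X i n t'|) := by
  sorry

/-! ## Stub 3 — adjacency / first entry through the bottom scale (F3 + the one-sided source) -/

/-- **stub_adjacency** (first-entry lemma; size M; a finite-dimensional maximum principle, no
solution context needed).  For `δ ≤ δ₀(lam,m,coeff)` there is `η = η(lam,m,coeff,δ) > 0` such that: if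
the block `{n ≥ k+1}` solves the circuit ODE on `[s,t']`, is `δ/2`-quiet at `s`, stays `≤ δ` on
`[s,t']`, and some block scale is `≥ δ` at `t'`, then scale `k` had amplitude `≥ η` at some
`u ∈ [s,t']`.  WHY (the card's lever, read at one scale): in `circuitRHS … i n t` every monomial
contains a factor `X_{·,n}` or `X_{·,n+1}` EXCEPT the single source `coeff(i₁,i₂,i,some 2)·lam^{n-1}·
X_{i₁,n-1} X_{i₂,n-1}` (offset `(0,0,1)`; `S` has no `(0,1,1)`).  In critical units, for `n ≥ k+2` all
factors live in the block, so `ȧ_{i,n} ≤ lam^{4n/5}(-a_{i,n} + 4m²Kδ²)` and `a_{i,n}` cannot leave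
`[0, δ/2]` when `8m²Kδ ≤ 1`; hence the crossing scale is `k+1`, whose only way to grow past
`max(δ/2, 3m²Kδ² + m²K lam^{-3/5} η²) < δ` is a source `a_k ≥ η`, `η² := δ lam^{3/5}/(8 m² K)` (any
`K ≥ max |coeff|`, `K > 0`).  Degenerate instances (`m = 0`, `coeff = 0`) make the crossing hypothesis
unsatisfiable, so they are true, not vacuous-false (triage objection to the ideator's typing answered:
no free bound `A`).  Leans on: `Theorems.CircuitTrace.Negative.circuitRHS` (unfold + `Fintype.sum_option`),
first-exit-time comparison for scalar ODE inequalities.  Checked numerically by all three triagers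
(adjacency_check.py 0/1200 violations). -/
theorem stub_adjacency :
    ∀ lam : ℝ, 1 < lam → ∀ (m : ℕ) (coeff : Fin m → Fin m → Fin m → Option (Fin 3) → ℝ),
    ∃ δ₀ : ℝ, 0 < δ₀ ∧ ∀ δ : ℝ, 0 < δ → δ ≤ δ₀ → ∃ η : ℝ, 0 < η ∧
      ∀ (X : Fin m → ℤ → ℝ → ℝ) (k : ℕ) (s t' : ℝ), s ≤ t' →
      (∀ (i : Fin m) (n : ℤ), (k : ℤ) + 1 ≤ n → ∀ t ∈ Set.Icc s t',
        HasDerivAt (X i n) (Summit.NavierStokesRegularity.NavierStokesRegularity.Theorems.CircuitTrace.Negative.circuitRHS lam coeff X i n t) t) →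
      (∀ (i : Fin m) (n : ℤ), (k : ℤ) + 1 ≤ n → lam ^ ((1 / 5 : ℝ) * n) * |X i n s| ≤ δ / 2) →
      (∀ (i : Fin m) (n : ℤ), (k : ℤ) + 1 ≤ n → ∀ t ∈ Set.Icc s t',
        lam ^ ((1 / 5 : ℝ) * n) * |X i n t| ≤ δ) →
      (∃ (i : Fin m) (n : ℤ), (k : ℤ) + 1 ≤ n ∧ δ ≤ lam ^ ((1 / 5 : ℝ) * n) * |X i n t'|) →
      ∃ u ∈ Set.Icc s t', ∃ i : Fin m, η ≤ lam ^ ((1 / 5 : ℝ) * k) * |X i k u| := by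
  sorry

/-! ## Stub 4 — band/block observability (F1: the card's lever; weighted critical-unit backward Grönwall) -/

/-- **stub_observability** (BAND OBSERVABILITY with zero bottom leak = the weighted, critical-unit
version of the disprover's `block_backward_gronwall`; size M).  For `θ ∈ (0,1)` and an `ℓ^∞`-critical
bound `Mc` there is `L = L(lam, m, coeff, θ, Mc) ≥ 0` such that for every solution segment of the block
`{0,…,N}` on `[u,t]` (ODE for the scales `≤ N`, nothing below scale `0`, amplitudes `≤ Mc` on the scales
`≤ N+1`): the `θ`-discounted critical amplitude of ANY block mode `(i₀,q₀)` at the EARLIER time `u`,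
damped by `exp(-L·lam^{4N/5}(t-u))` (the clock of the TOP scale — the block is slow), is dominated by
the discounted amplitude of SOME block mode `(i₁,q₁)` at the later time `t`.  WHY: with
`w_{i,q} := θ^{N-q} lam^{q/5} X_{i,q}`, each monomial of `ẇ_{i,q}` carries a factor at a scale `≤ q`
(one-sided coupling; the `(q-1)²` source costs `θ⁻¹`, and vanishes for `q = 0` by the cutoff), the other
factor is `≤ Mc`, and the rates are `lam^{4q/5} ≤ lam^{4N/5}`: `|ẇ_{i,q}| ≤ lam^{4N/5}(1 + 4m²K Mc/θ)‖w‖_∞`,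
so `‖w(t)‖_∞ ≥ e^{-L lam^{4N/5}(t-u)}‖w(u)‖_∞` by Grönwall in reversed time.  No symmetry, no
cancellation, no a-priori bound, no `ℓ³`.  Leans on: `Theorems.CircuitTrace.Negative.circuitRHS`,
the LANDED `Theorems.CircuitTrace.Negative.block_backward_gronwall` / `circuitRHS_abs_le` /
`exists_coeff_bound` (Negative/Structure.lean, imported: copy the proof and insert the weights
`θ^{N-q} lam^{q/5}`), Mathlib `norm_le_gronwallBound_of_norm_deriv_right_le`, `gronwallBound_ε0`,
`hasDerivAt_pi`, `pi_norm_le_iff_of_nonneg`.  `m = 0`: vacuous in `i₀`, true.  (Disproof v3 §6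
records the ideator's `BandObservability` as TRUE; this is it with the band `{0..N}`, leak zero.) -/
theorem stub_observability :
    ∀ lam : ℝ, 1 < lam → ∀ (m : ℕ) (coeff : Fin m → Fin m → Fin m → Option (Fin 3) → ℝ)
      (θ Mc : ℝ), 0 < θ → θ < 1 → 0 ≤ Mc →
    ∃ L : ℝ, 0 ≤ L ∧ ∀ (X : Fin m → ℤ → ℝ → ℝ) (N : ℕ) (u t : ℝ), u ≤ t →
      (∀ (i : Fin m) (n : ℤ), n ≤ N → ∀ τ ∈ Set.Icc u t,
        HasDerivAt (X i n) (Summit.NavierStokesRegularity.NavierStokesRegularity.Theorems.CircuitTrace.Negative.circuitRHS lam coeff X i n τ) τ) →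
      (∀ (i : Fin m) (n : ℤ) (τ : ℝ), n < 0 → X i n τ = 0) →
      (∀ (i : Fin m) (n : ℤ), n ≤ N + 1 → ∀ τ ∈ Set.Icc u t,
        lam ^ ((1 / 5 : ℝ) * n) * |X i n τ| ≤ Mc) →
      ∀ (i₀ : Fin m) (q₀ : ℕ), q₀ ≤ N →
        ∃ (i₁ : Fin m) (q₁ : ℕ), q₁ ≤ N ∧
          Real.exp (-(L * (lam ^ ((4 / 5 : ℝ) * N) * (t - u)))) *
              (θ ^ (N - q₀) * (lam ^ ((1 / 5 : ℝ) * q₀) * |X i₀ q₀ u|))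
            ≤ θ ^ (N - q₁) * (lam ^ ((1 / 5 : ℝ) * q₁) * |X i₁ q₁ t|) := by
  sorry

/-! ## Stub 5 — frozen trail + ℓ³ counting (Disproof steps 3–4) -/

/-- **stub_trailDivergence** (frozen-trail theorem + pigeonhole; size M/L).  GIVEN block observability
(the statement of `stub_observability`, taken as the first hypothesis so that this stub is independent
of how that one is proved) and SYNCHRONY WITNESSES (`∃ δ > 0, C, k₀` such that every scale `k ≥ k₀` has
a mode of critical amplitude `≥ δ` at some time `u_k ∈ (0,T)` with `T - u_k ≤ C lam^{-4k/5}`), a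
solution of the circuit ODE on `(0,T)` with no modes below `0` cannot have bounded `ℓ³`-in-scale
critical norm.  Proof sketch: `Mc := max M 1` bounds every `a_{i,n}` (one-term sums); fix `θ = 1/2`,
`L` from observability, `ρ := exp(-L·max C 0)·δ`, `D := ⌈log(Mc/ρ)/log 2⌉`.  For `K ≥ k₀` let
`t* := max_{k₀ ≤ k ≤ K} u_k ∈ (0,T)`.  For each such `k`, observability on the block `{0..k}` over
`[u_k, t*]` (note `lam^{4k/5}(t*-u_k) ≤ lam^{4k/5}(T-u_k) ≤ C`) with `(i₀,q₀) = (i,k)` yields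
`q_k ≤ k` with `θ^{k-q_k} a_{·,q_k}(t*) ≥ ρ`, hence `a_{·,q_k}(t*) ≥ ρ` and `k - q_k ≤ D`; the map
`k ↦ q_k` is at most `(D+1)`-to-one, so the finset `{q_k}` has `≥ (K-k₀+1)/(D+1)` elements and
`Σ_{q ∈ {q_k}} Σ_i a_{i,q}(t*)³ ≥ (K-k₀+1)ρ³/(D+1) > M` for `K` large: contradiction with the `ℓ³`
bound at `t* ∈ [0,T)`.  Holds verbatim with `3 ↦ q` for any `q < ∞` (`CircuitTraceLq`), and gives
nothing at `q = ∞` (the frozen trail of the Type-I facet's witness has `ℓ^q ≍ k^{1/q}`), as it must.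
Leans on: `Finset.card_le_mul_card_image` / `Finset.exists_ne_map_eq_of_card_lt_of_maps_to`
(pigeonhole), `Finset.sum_le_sum`, `Real.exp`, `Real.log` arithmetic, `Finset.exists_max_image`
(for `t*`). -/
theorem stub_trailDivergence :
    (∀ lam : ℝ, 1 < lam → ∀ (m : ℕ) (coeff : Fin m → Fin m → Fin m → Option (Fin 3) → ℝ)
        (θ Mc : ℝ), 0 < θ → θ < 1 → 0 ≤ Mc →
      ∃ L : ℝ, 0 ≤ L ∧ ∀ (X : Fin m → ℤ → ℝ → ℝ) (N : ℕ) (u t : ℝ), u ≤ t →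
        (∀ (i : Fin m) (n : ℤ), n ≤ N → ∀ τ ∈ Set.Icc u t,
          HasDerivAt (X i n) (Summit.NavierStokesRegularity.NavierStokesRegularity.Theorems.CircuitTrace.Negative.circuitRHS lam coeff X i n τ) τ) →
        (∀ (i : Fin m) (n : ℤ) (τ : ℝ), n < 0 → X i n τ = 0) →
        (∀ (i : Fin m) (n : ℤ), n ≤ N + 1 → ∀ τ ∈ Set.Icc u t,
          lam ^ ((1 / 5 : ℝ) * n) * |X i n τ| ≤ Mc) →
        ∀ (i₀ : Fin m) (q₀ : ℕ), q₀ ≤ N →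
          ∃ (i₁ : Fin m) (q₁ : ℕ), q₁ ≤ N ∧
            Real.exp (-(L * (lam ^ ((4 / 5 : ℝ) * N) * (t - u)))) *
                (θ ^ (N - q₀) * (lam ^ ((1 / 5 : ℝ) * q₀) * |X i₀ q₀ u|))
              ≤ θ ^ (N - q₁) * (lam ^ ((1 / 5 : ℝ) * q₁) * |X i₁ q₁ t|)) →
    ∀ lam : ℝ, 1 < lam → ∀ (m : ℕ) (coeff : Fin m → Fin m → Fin m → Option (Fin 3) → ℝ)
      (T : ℝ), 0 < T → ∀ X : Fin m → ℤ → ℝ → ℝ,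
    (∀ (i : Fin m) (n : ℤ), ∀ t ∈ Set.Ioo 0 T,
      HasDerivAt (X i n) (Summit.NavierStokesRegularity.NavierStokesRegularity.Theorems.CircuitTrace.Negative.circuitRHS lam coeff X i n t) t) →
    (∀ (i : Fin m) (n : ℤ) (t : ℝ), n < 0 → X i n t = 0) →
    (∃ M : ℝ, ∀ t ∈ Set.Ico 0 T, ∀ s : Finset ℤ,
      ∑ n ∈ s, ∑ i : Fin m, (lam ^ ((1 / 5 : ℝ) * n) * |X i n t|) ^ 3 ≤ M) →
    (∃ δ : ℝ, 0 < δ ∧ ∃ C : ℝ, ∃ k₀ : ℕ, ∀ k : ℕ, k₀ ≤ k → ∃ u ∈ Set.Ioo 0 T,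
      T - u ≤ C * lam ^ (-((4 / 5 : ℝ) * k)) ∧
        ∃ i : Fin m, δ ≤ lam ^ ((1 / 5 : ℝ) * k) * |X i k u|) →
    False := by
  sorry

/-! ## The composition (sorry-free): the five stubs ⇒ `PerpetualPump.CircuitTrace` by name -/

/-- **CircuitTrace_of** — the line closes the crux modulo exactly the five registered stubs.
Logic: unfold the crux (`circuitTrace_iff`, `Iff.rfl`); assume the `H¹⁰` bound fails; `stub_quietTail`
turns that into tail recurrence; `stub_clock` gives, for every large `k`, the last-quiet / first-crossing
window `[s,t']` of the block `{n ≥ k+1}` inside the Type-I clock; `stub_adjacency` finds scale `k`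
active (`≥ η`) inside that window — these are the synchrony witnesses; `stub_trailDivergence`, fed with
`stub_observability`, contradicts the `ℓ³` bound. -/
theorem CircuitTrace_of : CircuitTrace := by
  refine Summit.NavierStokesRegularity.NavierStokesRegularity.Theorems.CircuitTrace.Negative.circuitTrace_iff.mpr ?_
  intro lam hlam m coeff hsym hcyc T hT X hcont hode hcut hapr hM
  by_contra hB
  obtain ⟨δ₁, hδ₁, hquiet⟩ :=
    stub_quietTail lam hlam m coeff hsym hcyc T hT X hcont hode hcut hapr hM
  have hTA : ¬ ∃ (k : ℕ) (t₁ : ℝ), t₁ ∈ Set.Ioo 0 T ∧ ∀ t ∈ Set.Ico t₁ T, ∀ (i : Fin m) (n : ℤ),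
      (k : ℤ) + 1 ≤ n → lam ^ ((1 / 5 : ℝ) * n) * |X i n t| ≤ δ₁ :=
    fun h => hB (hquiet h)
  obtain ⟨δ₀, hδ₀, hadj⟩ := stub_adjacency lam hlam m coeff
  obtain ⟨δ, hδ, hδle, C, k₀, hk⟩ :=
    stub_clock lam hlam m coeff hsym hcyc T hT X hcont hode hcut hapr hM δ₁ hδ₁ hTA δ₀ hδ₀
  obtain ⟨η, hη, hadjη⟩ := hadj δ hδ hδle
  refine stub_trailDivergence stub_observability lam hlam m coeff T hT X hode hcut hM
    ⟨η, hη, C, k₀, fun k hk' => ?_⟩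
  obtain ⟨s, t', hs, hst, ht', hTs, hQ, hBlk, hX⟩ := hk k hk'
  have hode' : ∀ (i : Fin m) (n : ℤ), (k : ℤ) + 1 ≤ n → ∀ t ∈ Set.Icc s t',
      HasDerivAt (X i n) (Summit.NavierStokesRegularity.NavierStokesRegularity.Theorems.CircuitTrace.Negative.circuitRHS lam coeff X i n t) t :=
    fun i n _ t ht => hode i n t ⟨lt_of_lt_of_le hs ht.1, lt_of_le_of_lt ht.2 ht'⟩
  obtain ⟨u, hu, i, hi⟩ := hadjη X k s t' hst hode' hQ hBlk hX
  exact ⟨u, ⟨lt_of_lt_of_le hs hu.1, lt_of_le_of_lt hu.2 ht'⟩, by linarith [hu.1], i, hi⟩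

end Summit.NavierStokesRegularity.NavierStokesRegularity.Cruxes.CircuitTrace.OneSidedSourceCascade

end
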